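import Literature.ComputerArithmetic.Lefevre2005.SegmentGrid
import HarnessLib

/-!
# The three-distance (three gap, Steinhaus) theorem

"The three gap theorem (or Steinhaus conjecture) asserts that there are at most three distinct gap lengths in
the fractional parts of the sequence `α, 2α, …, Nα`, for any integer `N` and real number `α`"
[MarklofStrombergsson2017, Abstract; proved there as Proposition 2 ⟹ the theorem]; first proved by
Sós [Sos1958], Surányi and Świerczkowski (1958); in the form used by the worst-case searches for correct
rounding: "the intervals can have at most three possible lengths (`h`, `ℓ` and `h − ℓ`) in any configuration …
on a circle with points added by successive constant rotations, the distances between two adjacent points of any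
configuration can take at most three possible values" [Lefevre2005, §2.2].

## Statement formalised

For `a` in a linearly ordered field `K` with a floor function (`ℝ` in the sources; `ℚ` computes) and `n ≥ 2`,
consider the `n` points `{k·a}`, `k < n`, on the circle `K/ℤ` (`{·} = Int.fract`; the first point is `0`,
[Lefevre2005]'s indexing — [MarklofStrombergsson2017] index `1 … N`, the same set of gaps up to the rotation
by `a`). The GAP of the point of index `k` is the distance to the next point met going right,
`min_{k' ≠ k} {(k' − k)·a}`; we phrase "`ℓ` is that minimum" as `IsGap a n k ℓ` (attained by some `k' ≠ k`,
and a lower bound for all), so no `Finset.min` bookkeeping enters the statement.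

**THEOREM `three_distance`.** If the `n` points are pairwise distinct (`{k·a} ≠ 0` for `0 < k < n` — automatic
for irrational `a`, `three_distance_of_irrational`), there are `ℓ₁, ℓ₂ > 0` such that every gap is `ℓ₁`, `ℓ₂`
or `ℓ₁ + ℓ₂`: at most three lengths, "one being the sum of the two others".

## Proof route (not the lattice proof of [MarklofStrombergsson2017])

We follow [Lefevre2005, §2.2] as formalised in `Literature.ComputerArithmetic.Lefevre2005.SegmentGrid`: the
two-length configurations `IsConfig a u v x y` (the `u + v` points cut the circle into `u` arcs of length `x`
and `v` arcs of length `y`) and their transitions `splitX` / `splitY`. Every `n ≥ 2` lies inside a transition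
(`exists_config`): `u + v ≤ n ≤ u + v + u` while the arcs of length `x > y` are being split into `x − y` and `y`
(gaps `⊆ {x − y, y, x}`), or `u + v ≤ n ≤ u + v + v` while the arcs of length `y > x` are split into `x` and
`y − x` (gaps `⊆ {x, y − x, y}`). The right neighbour of each point is explicit — index `k + v` or `k − u` in a
configuration (the classical "neighbour indices differ by `v` or `−u`"), the new point `u + v + k` for a split arc
— which is what makes the gaps computable from the fields of `IsConfig`.
-/

namespace Literature.NumberTheory.DiophantineApproximation

open Literature.ComputerArithmetic.Lefevre2005

variable {K : Type*} [Field K] [LinearOrder K] [IsStrictOrderedRing K] [FloorRing K]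

section FractToolkit

/-- `{p + q} = {p} + {q}` when the sum of the fractional parts is `< 1`. [folklore] -/
private theorem fract_add_of_lt {p q : K} (h : Int.fract p + Int.fract q < 1) :
    Int.fract (p + q) = Int.fract p + Int.fract q := by
  rw [Int.fract_eq_iff]
  refine ⟨add_nonneg (Int.fract_nonneg p) (Int.fract_nonneg q), h, ⌊p⌋ + ⌊q⌋, ?_⟩
  rw [Int.cast_add, ← Int.self_sub_fract p, ← Int.self_sub_fract q]; ring

/-- `{p - q} = {p} - {q}` when `{q} ≤ {p}`. [folklore] -/
private theorem fract_sub_of_le {p q : K} (h : Int.fract q ≤ Int.fract p) :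
    Int.fract (p - q) = Int.fract p - Int.fract q := by
  rw [Int.fract_eq_iff]
  refine ⟨sub_nonneg.2 h, by linarith [Int.fract_lt_one p, Int.fract_nonneg q], ⌊p⌋ - ⌊q⌋, ?_⟩
  rw [Int.cast_sub, ← Int.self_sub_fract p, ← Int.self_sub_fract q]; ring

end FractToolkit

/-- `ℓ` is the gap to the right of the point of index `k` among the `n` points `{k'·a}`, `k' < n`: some other
point is at distance exactly `ℓ` going right (`{(k' − k)·a} = ℓ`), and none is closer.
[cite: MarklofStrombergsson2017, §1 (the gap `s_{k,N}`)] -/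
structure IsGap (a : K) (n k : ℕ) (ℓ : K) : Prop where
  attained : ∃ k' : ℕ, k' < n ∧ k' ≠ k ∧ Int.fract (((k' : K) - (k : K)) * a) = ℓ
  le : ∀ k' : ℕ, k' < n → k' ≠ k → ℓ ≤ Int.fract (((k' : K) - (k : K)) * a)

omit [IsStrictOrderedRing K] in
/-- The gap is unique (it is a minimum). [cite: MarklofStrombergsson2017, §1] -/
theorem IsGap.unique {a ℓ ℓ' : K} {n k : ℕ} (h : IsGap a n k ℓ) (h' : IsGap a n k ℓ') :
    ℓ = ℓ' := by
  obtain ⟨k₁, hk₁, hne₁, e₁⟩ := h.attained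
  obtain ⟨k₂, hk₂, hne₂, e₂⟩ := h'.attained
  exact le_antisymm (e₂ ▸ h.le k₂ hk₂ hne₂) (e₁ ▸ h'.le k₁ hk₁ hne₁)

/-! ### Every `n ≥ 2` lies inside a transition between two-length configurations -/

/-- Starting from Lefèvre's initial configuration and splitting as long as fewer than `n` points are placed:
for `n ≥ 2` distinct points there is a configuration `(u, v, x, y)` with `u + v ≤ n` which is either exactly
the `n` points, or in the middle of splitting its long arcs (`y < x`: at most `u` more points; `x < y`: at
most `v`). [cite: Lefevre2005, §2.2] -/
theorem exists_config (a : K) {n : ℕ} (hn : 2 ≤ n)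
    (hdist : ∀ k : ℕ, 0 < k → k < n → Int.fract ((k : K) * a) ≠ 0) :
    ∃ u v : ℕ, ∃ x y : K, IsConfig a u v x y ∧ u + v ≤ n ∧
      (n = u + v ∨ (y < x ∧ n ≤ u + v + u) ∨ (x < y ∧ n ≤ u + v + v)) := by
  have ha : Int.fract a ≠ 0 := by simpa using hdist 1 Nat.one_pos (by omega)
  -- induction on the number of points still to be placed
  have key : ∀ m : ℕ, ∀ u v : ℕ, ∀ x y : K, IsConfig a u v x y → u + v ≤ n → n - (u + v) ≤ m →
      ∃ u v : ℕ, ∃ x y : K, IsConfig a u v x y ∧ u + v ≤ n ∧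
        (n = u + v ∨ (y < x ∧ n ≤ u + v + u) ∨ (x < y ∧ n ≤ u + v + v)) := by
    intro m
    induction m with
    | zero =>
      intro u v x y hc hle hm
      exact ⟨u, v, x, y, hc, hle, Or.inl (by omega)⟩
    | succ m ih =>
      intro u v x y hc hle hm
      by_cases heq : n = u + v
      · exact ⟨u, v, x, y, hc, hle, Or.inl heq⟩
      have hlt : u + v < n := lt_of_le_of_ne hle (Ne.symm heq)
      have hxy : x ≠ y := fun e =>
        hdist (u + v) (Nat.add_pos_left hc.u_pos v) hlt (by exact_mod_cast hc.fract_n_eq_zero e)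
      rcases lt_or_gt_of_ne hxy with h | h
      · -- `x < y`: the arcs of length `y` are split next
        by_cases hn' : n ≤ u + v + v
        · exact ⟨u, v, x, y, hc, hle, Or.inr (Or.inr ⟨h, hn'⟩)⟩
        · have hu := hc.v_pos
          exact ih (u + v) v x (y - x) (hc.splitY h) (by omega) (by omega)
      · by_cases hn' : n ≤ u + v + u
        · exact ⟨u, v, x, y, hc, hle, Or.inr (Or.inl ⟨h, hn'⟩)⟩
        · have hu := hc.u_pos
          obtain ⟨u', v', x', y', h1, h2, h3⟩ :=
            ih u (v + u) (x - y) y (hc.splitX h) (by omega) (by omega)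
          exact ⟨u', v', x', y', h1, h2, h3⟩
  exact key n 1 1 (Int.fract a) (1 - Int.fract a) (IsConfig.init a ha) hn (by omega)

/-! ### The gaps of a two-length configuration and of a configuration being split -/

section Gaps

variable {a x y : K} {u v : ℕ}

omit [IsStrictOrderedRing K] in
/-- In a configuration, the point of index `k < u` has its right neighbour at index `k + v`, distance `x`.
[cite: Lefevre2005, §2.2] -/
theorem isGap_x (hc : IsConfig a u v x y) {n k : ℕ} (hk : k < u) (hn : u + v ≤ n)
    (hnew : ∀ k' : ℕ, u + v ≤ k' → k' < n → x ≤ Int.fract (((k' : K) - (k : K)) * a)) :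
    IsGap a n k x := by
  refine ⟨⟨k + v, by omega, by have := hc.v_pos; omega, ?_⟩, fun k' hk' hne => ?_⟩
  · rw [show (((k + v : ℕ) : K) - (k : K)) * a = (v : K) * a by push_cast; ring, hc.fract_v]
  · by_cases hk'n : k' < u + v
    · have g := hc.gap (show k < u + v by omega) hk'n (Ne.symm hne)
      rwa [if_pos hk] at g
    · exact hnew k' (not_lt.1 hk'n) hk'

/-- In a configuration, the point of index `u + j` has its right neighbour at index `j`, distance `y`.
[cite: Lefevre2005, §2.2] -/
theorem isGap_y (hc : IsConfig a u v x y) {n j : ℕ} (hj : j < v) (hn : u + v ≤ n)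
    (hnew : ∀ k' : ℕ, u + v ≤ k' → k' < n → y ≤ Int.fract (((k' : K) - ((u + j : ℕ) : K)) * a)) :
    IsGap a n (u + j) y := by
  have hu1 : Int.fract ((u : K) * a) ≠ 0 := by rw [hc.fract_u]; linarith [hc.y_lt_one]
  refine ⟨⟨j, by omega, by have := hc.u_pos; omega, ?_⟩, fun k' hk' hne => ?_⟩
  · rw [show (((j : ℕ) : K) - ((u + j : ℕ) : K)) * a = -((u : K) * a) by push_cast; ring,
      Int.fract_neg hu1, hc.fract_u]; ring
  · by_cases hk'n : k' < u + v
    · have g := hc.gap (show u + j < u + v by omega) hk'n (Ne.symm hne)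
      rwa [if_neg (by omega)] at g
    · exact hnew k' (not_lt.1 hk'n) hk'

/-- Splitting the arcs of length `x` (`y < x`): the distance from an OLD point `k` to a NEW point `u + v + j`,
`j ≠ k`, is `{(j − k)·a} + (x − y) ≥ ℓ(k) + (x − y)`. [cite: Lefevre2005, §2.2] -/
theorem dist_old_new_X (hc : IsConfig a u v x y) (hyx : y < x) {k j : ℕ} (hk : k < u + v) (hj : j < u)
    (hne : j ≠ k) :
    Int.fract ((((u + v + j : ℕ) : K) - (k : K)) * a)
      = Int.fract (((j : K) - (k : K)) * a) + (x - y) := by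
  have hs := hc.fract_n_of_lt hyx
  have g2 := hc.gap_le hk (show j < u + v by omega) (Ne.symm hne)
  rw [if_pos hj] at g2
  have e : (((u + v + j : ℕ) : K) - (k : K)) * a = ((j : K) - (k : K)) * a + ((u + v : ℕ) : K) * a := by
    push_cast; ring
  have hlt : Int.fract (((j : K) - (k : K)) * a) + Int.fract (((u + v : ℕ) : K) * a) < 1 := by
    rw [hs]; linarith [hc.y_pos]
  rw [e, fract_add_of_lt hlt, hs]

/-- Splitting the arcs of length `y` (`x < y`): the distance from an OLD point `k` to a NEW point `u + v + j`,
`u + j ≠ k`, is `{(u + j − k)·a} + x`. [cite: Lefevre2005, §2.2] -/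
theorem dist_old_new_Y (hc : IsConfig a u v x y) (hxy : x < y) {k j : ℕ} (hk : k < u + v) (hj : j < v)
    (hne : u + j ≠ k) :
    Int.fract ((((u + v + j : ℕ) : K) - (k : K)) * a)
      = Int.fract ((((u + j : ℕ) : K) - (k : K)) * a) + x := by
  have hv := hc.fract_v
  have g2 := hc.gap_le hk (show u + j < u + v by omega) (Ne.symm hne)
  rw [if_neg (by omega)] at g2
  have e : (((u + v + j : ℕ) : K) - (k : K)) * a = (((u + j : ℕ) : K) - (k : K)) * a + (v : K) * a := by
    push_cast; ring
  have hlt : Int.fract ((((u + j : ℕ) : K) - (k : K)) * a) + Int.fract ((v : K) * a) < 1 := by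
    rw [hv]; linarith
  rw [e, fract_add_of_lt hlt, hv]

/-- **Gaps while the arcs of length `x > y` are being split** (`n = u + v + s` points, `s ≤ u`: the arcs of
index `< s` are split into `x − y` then `y`): every gap is `x − y`, `y` or `x`. [cite: Lefevre2005, §2.2] -/
theorem gaps_splitX (hc : IsConfig a u v x y) (hyx : y < x) {s : ℕ} (hs : s ≤ u) {k : ℕ}
    (hk : k < u + v + s) : ∃ ℓ : K, IsGap a (u + v + s) k ℓ ∧ (ℓ = x - y ∨ ℓ = y ∨ ℓ = x - y + y) := by
  have hxpos := hc.x_pos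
  have hypos := hc.y_pos
  have hfs := hc.fract_n_of_lt hyx
  by_cases hkold : k < u + v
  · by_cases hku : k < u
    · by_cases hks : k < s
      · -- a split arc of length `x`: its new right neighbour `u + v + k` is at distance `x − y`
        refine ⟨x - y, ⟨⟨u + v + k, by omega, by omega, ?_⟩, fun k' hk' hne => ?_⟩, Or.inl rfl⟩
        · rw [show (((u + v + k : ℕ) : K) - (k : K)) * a = ((u + v : ℕ) : K) * a by push_cast; ring, hfs]
        · by_cases hk'old : k' < u + v
          · have g := hc.gap hkold hk'old (Ne.symm hne); rw [if_pos hku] at g; linarith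
          · obtain ⟨j, rfl⟩ : ∃ j, k' = u + v + j := ⟨k' - (u + v), by omega⟩
            by_cases hjk : j = k
            · subst hjk
              rw [show (((u + v + j : ℕ) : K) - (j : K)) * a = ((u + v : ℕ) : K) * a by push_cast; ring, hfs]
            · rw [dist_old_new_X hc hyx hkold (by omega) hjk]
              have g := hc.gap hkold (show j < u + v by omega) (Ne.symm hjk); rw [if_pos hku] at g
              linarith
      · -- an arc of length `x` not yet split
        refine ⟨x - y + y, ?_, Or.inr (Or.inr rfl)⟩
        rw [sub_add_cancel]
        refine isGap_x hc hku (by omega) fun k' hk'1 hk'2 => ?_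
        obtain ⟨j, rfl⟩ : ∃ j, k' = u + v + j := ⟨k' - (u + v), by omega⟩
        have hjk : j ≠ k := by omega
        rw [dist_old_new_X hc hyx hkold (by omega) hjk]
        have g := hc.gap hkold (show j < u + v by omega) (Ne.symm hjk); rw [if_pos hku] at g
        linarith
    · -- an arc of length `y`
      obtain ⟨i, rfl⟩ : ∃ i, k = u + i := ⟨k - u, by omega⟩
      refine ⟨y, ?_, Or.inr (Or.inl rfl)⟩
      refine isGap_y hc (by omega) (by omega) fun k' hk'1 hk'2 => ?_
      obtain ⟨j, rfl⟩ : ∃ j, k' = u + v + j := ⟨k' - (u + v), by omega⟩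
      have hjk : j ≠ u + i := by omega
      rw [dist_old_new_X hc hyx hkold (show j < u by omega) hjk]
      have g := hc.gap hkold (show j < u + v by omega) (Ne.symm hjk); rw [if_neg hku] at g
      linarith
  · -- a new point `u + v + j`: its right neighbour is `j + v`, at distance `y`
    obtain ⟨j, rfl⟩ : ∃ j, k = u + v + j := ⟨k - (u + v), by omega⟩
    have hj : j < s := by omega
    have hu1 : Int.fract ((u : K) * a) ≠ 0 := by rw [hc.fract_u]; linarith [hc.y_lt_one]
    refine ⟨y, ⟨⟨j + v, by omega, by omega, ?_⟩, fun k' hk' hne => ?_⟩, Or.inr (Or.inl rfl)⟩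
    · rw [show (((j + v : ℕ) : K) - ((u + v + j : ℕ) : K)) * a = -((u : K) * a) by push_cast; ring,
        Int.fract_neg hu1, hc.fract_u]; ring
    · by_cases hk'old : k' < u + v
      · have e : (((k' : ℕ) : K) - ((u + v + j : ℕ) : K)) * a
            = ((k' : K) - (j : K)) * a - ((u + v : ℕ) : K) * a := by push_cast; ring
        by_cases hk'j : k' = j
        · subst hk'j
          have hne0 : Int.fract (((u + v : ℕ) : K) * a) ≠ 0 := by rw [hfs]; linarith
          rw [e, show ((k' : K) - (k' : K)) * a = 0 by ring, zero_sub, Int.fract_neg hne0, hfs]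
          linarith [hc.x_lt_one]
        · have g := hc.gap (show j < u + v by omega) hk'old (Ne.symm hk'j); rw [if_pos (by omega)] at g
          have hle : Int.fract (((u + v : ℕ) : K) * a) ≤ Int.fract (((k' : K) - (j : K)) * a) := by
            rw [hfs]; linarith
          rw [e, fract_sub_of_le hle, hfs]; linarith
      · obtain ⟨j', rfl⟩ : ∃ j', k' = u + v + j' := ⟨k' - (u + v), by omega⟩
        have hjj : j ≠ j' := fun e => hne (by rw [e])
        rw [show (((u + v + j' : ℕ) : K) - ((u + v + j : ℕ) : K)) * a = ((j' : K) - (j : K)) * a by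
          push_cast; ring]
        have g := hc.gap (show j < u + v by omega) (show j' < u + v by omega) hjj
        rw [if_pos (by omega)] at g; linarith

/-- **Gaps while the arcs of length `y > x` are being split** (`n = u + v + s` points, `s ≤ v`: the arcs with
left end `u + j`, `j < s`, are split into `x` then `y − x`): every gap is `x`, `y − x` or `y`.
[cite: Lefevre2005, §2.2] -/
theorem gaps_splitY (hc : IsConfig a u v x y) (hxy : x < y) {s : ℕ} (hs : s ≤ v) {k : ℕ}
    (hk : k < u + v + s) : ∃ ℓ : K, IsGap a (u + v + s) k ℓ ∧ (ℓ = x ∨ ℓ = y - x ∨ ℓ = x + (y - x)) := by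
  have hxpos := hc.x_pos
  have hypos := hc.y_pos
  have hv := hc.fract_v
  by_cases hkold : k < u + v
  · by_cases hku : k < u
    · -- an arc of length `x`: untouched
      refine ⟨x, ?_, Or.inl rfl⟩
      refine isGap_x hc hku (by omega) fun k' hk'1 hk'2 => ?_
      obtain ⟨j, rfl⟩ : ∃ j, k' = u + v + j := ⟨k' - (u + v), by omega⟩
      rw [dist_old_new_Y hc hxy hkold (by omega) (by omega)]
      linarith [Int.fract_nonneg ((((u + j : ℕ) : K) - (k : K)) * a)]
    · obtain ⟨i, rfl⟩ : ∃ i, k = u + i := ⟨k - u, by omega⟩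
      have hi : i < v := by omega
      by_cases his : i < s
      · -- a split arc of length `y`: its new right neighbour `u + v + i` is at distance `x`
        refine ⟨x, ⟨⟨u + v + i, by omega, by omega, ?_⟩, fun k' hk' hne => ?_⟩, Or.inl rfl⟩
        · rw [show (((u + v + i : ℕ) : K) - ((u + i : ℕ) : K)) * a = (v : K) * a by push_cast; ring, hv]
        · by_cases hk'old : k' < u + v
          · have g := hc.gap hkold hk'old (Ne.symm hne); rw [if_neg hku] at g; linarith
          · obtain ⟨j, rfl⟩ : ∃ j, k' = u + v + j := ⟨k' - (u + v), by omega⟩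
            by_cases hji : j = i
            · subst hji
              rw [show (((u + v + j : ℕ) : K) - ((u + j : ℕ) : K)) * a = (v : K) * a by push_cast; ring, hv]
            · rw [dist_old_new_Y hc hxy hkold (by omega) (by omega)]
              linarith [Int.fract_nonneg ((((u + j : ℕ) : K) - ((u + i : ℕ) : K)) * a)]
      · -- an arc of length `y` not yet split
        refine ⟨x + (y - x), ?_, Or.inr (Or.inr rfl)⟩
        rw [add_sub_cancel]
        refine isGap_y hc hi (by omega) fun k' hk'1 hk'2 => ?_
        obtain ⟨j, rfl⟩ : ∃ j, k' = u + v + j := ⟨k' - (u + v), by omega⟩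
        have hji : u + j ≠ u + i := by omega
        rw [dist_old_new_Y hc hxy hkold (by omega) hji]
        have g := hc.gap hkold (show u + j < u + v by omega) (Ne.symm hji); rw [if_neg hku] at g
        linarith
  · -- a new point `u + v + j` (at `{(u+j)·a} + x`): its right neighbour is `j`, at distance `y − x`
    obtain ⟨j, rfl⟩ : ∃ j, k = u + v + j := ⟨k - (u + v), by omega⟩
    have hj : j < s := by omega
    have hfs := hc.fract_n_of_gt hxy
    have hne0 : Int.fract (((u + v : ℕ) : K) * a) ≠ 0 := by rw [hfs]; linarith [hc.y_lt_one]
    refine ⟨y - x, ⟨⟨j, by omega, by omega, ?_⟩, fun k' hk' hne => ?_⟩, Or.inr (Or.inl rfl)⟩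
    · rw [show (((j : ℕ) : K) - ((u + v + j : ℕ) : K)) * a = -(((u + v : ℕ) : K) * a) by push_cast; ring,
        Int.fract_neg hne0, hfs]; ring
    · by_cases hk'old : k' < u + v
      · have e : (((k' : ℕ) : K) - ((u + v + j : ℕ) : K)) * a
            = ((k' : K) - ((u + j : ℕ) : K)) * a - (v : K) * a := by push_cast; ring
        by_cases hk'j : k' = u + j
        · subst hk'j
          have hne1 : Int.fract ((v : K) * a) ≠ 0 := by rw [hv]; exact hxpos.ne'
          rw [e, show (((u + j : ℕ) : K) - ((u + j : ℕ) : K)) * a = 0 by ring, zero_sub, Int.fract_neg hne1,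
            hv]
          linarith [hc.y_lt_one]
        · have g := hc.gap (show u + j < u + v by omega) hk'old (Ne.symm hk'j); rw [if_neg (by omega)] at g
          have hle : Int.fract ((v : K) * a) ≤ Int.fract (((k' : K) - ((u + j : ℕ) : K)) * a) := by
            rw [hv]; linarith
          rw [e, fract_sub_of_le hle, hv]; linarith
      · obtain ⟨j', rfl⟩ : ∃ j', k' = u + v + j' := ⟨k' - (u + v), by omega⟩
        have hjj : u + j ≠ u + j' := fun e => hne (by omega)
        rw [show (((u + v + j' : ℕ) : K) - ((u + v + j : ℕ) : K)) * a
            = (((u + j' : ℕ) : K) - ((u + j : ℕ) : K)) * a by push_cast; ring]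
        have g := hc.gap (show u + j < u + v by omega) (show u + j' < u + v by omega) hjj
        rw [if_neg (by omega)] at g; linarith

end Gaps

/-- **Three-distance theorem** (Sós 1958; Świerczkowski; Surányi; [MarklofStrombergsson2017]). For `n ≥ 2`
pairwise distinct points `{0}, {a}, …, {(n−1)·a}` on the circle, the gaps between neighbouring points take at
most three values, and when there are three the largest is the sum of the other two: there are `ℓ₁, ℓ₂ > 0`
with every gap in `{ℓ₁, ℓ₂, ℓ₁ + ℓ₂}`. [cite: MarklofStrombergsson2017, Abstract and §1; Lefevre2005, §2.2] -/
theorem three_distance (a : K) {n : ℕ} (hn : 2 ≤ n)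
    (hdist : ∀ k : ℕ, 0 < k → k < n → Int.fract ((k : K) * a) ≠ 0) :
    ∃ ℓ₁ ℓ₂ : K, 0 < ℓ₁ ∧ 0 < ℓ₂ ∧
      ∀ k : ℕ, k < n → ∃ ℓ : K, IsGap a n k ℓ ∧ (ℓ = ℓ₁ ∨ ℓ = ℓ₂ ∨ ℓ = ℓ₁ + ℓ₂) := by
  obtain ⟨u, v, x, y, hc, hle, hcase⟩ := exists_config a hn hdist
  rcases hcase with h | ⟨hyx, h⟩ | ⟨hxy, h⟩
  · -- exactly a two-length configuration: gaps `x` (indices `< u`) and `y`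
    refine ⟨x, y, hc.x_pos, hc.y_pos, fun k hk => ?_⟩
    by_cases hku : k < u
    · exact ⟨x, isGap_x hc hku (by omega) (fun k' h1 h2 => by exfalso; omega), Or.inl rfl⟩
    · obtain ⟨i, rfl⟩ : ∃ i, k = u + i := ⟨k - u, by omega⟩
      exact ⟨y, isGap_y hc (by omega) (by omega) (fun k' h1 h2 => by exfalso; omega), Or.inr (Or.inl rfl)⟩
  · -- splitting the arcs of length `x`
    obtain ⟨s, rfl⟩ : ∃ s, n = u + v + s := ⟨n - (u + v), by omega⟩
    refine ⟨x - y, y, sub_pos.2 hyx, hc.y_pos, fun k hk => ?_⟩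
    exact gaps_splitX hc hyx (by omega) hk
  · -- splitting the arcs of length `y`
    obtain ⟨s, rfl⟩ : ∃ s, n = u + v + s := ⟨n - (u + v), by omega⟩
    refine ⟨x, y - x, hc.x_pos, sub_pos.2 hxy, fun k hk => ?_⟩
    exact gaps_splitY hc hxy (by omega) hk

/-- The classical hypothesis: for irrational `a` the points `{k·a}` are pairwise distinct, so the three-distance
theorem applies to every `n ≥ 2`. [cite: MarklofStrombergsson2017, Abstract] -/
theorem three_distance_of_irrational {a : ℝ} (ha : Irrational a) {n : ℕ} (hn : 2 ≤ n) :
    ∃ ℓ₁ ℓ₂ : ℝ, 0 < ℓ₁ ∧ 0 < ℓ₂ ∧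
      ∀ k : ℕ, k < n → ∃ ℓ : ℝ, IsGap a n k ℓ ∧ (ℓ = ℓ₁ ∨ ℓ = ℓ₂ ∨ ℓ = ℓ₁ + ℓ₂) := by
  refine three_distance a hn fun k hk _ h0 => ?_
  have hka : Irrational ((k : ℝ) * a) := ha.natCast_mul (by omega)
  have e : (k : ℝ) * a = ((⌊(k : ℝ) * a⌋ : ℤ) : ℝ) := by
    have h := Int.self_sub_fract ((k : ℝ) * a)
    rw [h0, sub_zero] at h
    exact h
  exact hka.ne_int _ e

/-- Example over `ℚ` (the kernel evaluates `Int.fract`): `a = 14/45`, `n = 5` — points `0, 14, 28, 42, 11`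
(in 45ths); the fifth point has just cut the arc `[0, 14)` from the right into `11 + 3`: gaps `11/45` (index 0),
`3/45` (indices 3, 4) and `14/45 = 11/45 + 3/45` (indices 1, 2). [cite: MarklofStrombergsson2017, §1] -/
example : IsGap (14 / 45 : ℚ) 5 0 (11 / 45) ∧ IsGap (14 / 45 : ℚ) 5 4 (3 / 45) ∧
    IsGap (14 / 45 : ℚ) 5 1 (14 / 45) := by
  refine ⟨⟨⟨4, by norm_num, by norm_num, by decide +kernel⟩, fun k' hk' hne => ?_⟩,
    ⟨⟨1, by norm_num, by norm_num, by decide +kernel⟩, fun k' hk' hne => ?_⟩,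
    ⟨⟨2, by norm_num, by norm_num, by decide +kernel⟩, fun k' hk' hne => ?_⟩⟩
  all_goals (interval_cases k' <;> first | exact absurd rfl hne | decide +kernel)

end Literature.NumberTheory.DiophantineApproximation
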